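import Summits.ResolutionOfSingularities.ResolutionOfSingularities.Theorems.FrobeniusLadderFRationalResolutionFixedStratumChains
import Literature.AlgebraicGeometry.Resolution.RegularLocalRingsProofs
import Mathlib.RingTheory.KrullDimension.Field
import HarnessLib

/-!
# Crux `FrobeniusLadder.FRationalResolution` (stmt-ResolutionOfSingularities-15317), line `redirect`,
# stub `stub_diagonalizableQuotientResolution` — **the GENERIC POINT of a log stratum: a zero-dimensional-stratum point
# of dimension `n − rk F`** (brick of design C3 = the rank-2 stratum layer of the non-isolated case, memo
# MEMO-15317-leafhand2-g10 §2 (L2): at the generic point `η` of the stratum of `𝔭` the surface-case hypotheses `h0`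
# (`𝔪_{A_η} ≤ I(η)A_η`) and `hdimA` (`dim A_η = n − rk F_𝔭`) of lineage 2's point-blow-up recursion HOLD, so its
# singularity test runs at `η` and `…FixedStratumSingular` carries the verdict to every point of the stratum)

For a chart `φ : P → A` log regular at a prime `𝔭` with unit face `F_𝔭`: `A_𝔭/I(𝔭)A_𝔭` is a regular local ring, hence a
domain, so `I(𝔭)A_𝔭` is prime and `η := I(𝔭)A_𝔭 ∩ A` is a prime of `A` with `I(𝔭) ⊆ η ⊆ 𝔭` — the generic point of the
stratum of `𝔭` near `𝔭`.
* `ideal_eq_of_le_of_ideal_le` — Kato's ideal is constant along the stratum: `I(𝔭', φ) = I(𝔭, φ)` for `I(𝔭) ⊆ 𝔭' ⊆ 𝔭`;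
* `isPrime_map_ideal_of_isLogRegularAt`, `comap_map_ideal_le`, `ideal_le_comap_map_ideal` — `η` is a prime between
  `I(𝔭)` and `𝔭`;
* **`maximalIdeal_le_map_ideal_genericPoint`** — `𝔪_{A_η} ≤ I(η, φ)A_η`: the stratum of `η` is ZERO-dimensional (the
  hypothesis `h0` of `…ChartAlgebraFixedPointDim` / `…VertexChartRegularity` at `η`);
* **`ringKrullDim_genericPoint`** — if `φ` is log regular at `η` too: `dim A_η = n − rk F_η` (Kato (2.1)(ii) with
  `A_η/I(η)A_η` a field) — the hypothesis `hdimA` at `η` once the rank is `2`.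

Honest label: generic local algebra toward ONE leaf stub (no stub, crux or summit closed). No definitions, no named
facts, no sorry. [cite: Kato1994, Def. (2.1), (7.3)] [cite: Niziol2006, §2.1]
-/

noncomputable section

-- single-problem summit: the doubled namespace component is forced
set_option linter.dupNamespace false

open IsLocalRing Literature.AlgebraicGeometry.Resolution Literature.AlgebraicGeometry.Resolution.LogChart
open Summit.ResolutionOfSingularities.ResolutionOfSingularities.Theorems.FRationalResolution.FixedStratumChains

namespace Summit.ResolutionOfSingularities.ResolutionOfSingularities.Theorems.FRationalResolution.FixedStratumGenericPoint

universe u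

variable {A : Type u} [CommRing A] {n : ℕ} {P : AddSubmonoid (Fin n → ℤ)} {φ : Multiplicative P →* A}
  {𝔭 𝔭' : Ideal A} [𝔭.IsPrime] [𝔭'.IsPrime]

omit [𝔭.IsPrime] [𝔭'.IsPrime] in
/-- **Kato's ideal is constant along the stratum**: `I(𝔭) ⊆ 𝔭' ⊆ 𝔭 ⇒ I(𝔭', φ) = I(𝔭, φ)`.
[cite: Kato1994, Def. (2.1), (7.3)] -/
theorem ideal_eq_of_le_of_ideal_le (hle : 𝔭' ≤ 𝔭) (hI : ideal P φ 𝔭 ≤ 𝔭') : ideal P φ 𝔭' = ideal P φ 𝔭 := by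
  have hset : {p : P | φ (Multiplicative.ofAdd p) ∈ 𝔭'} = {p : P | φ (Multiplicative.ofAdd p) ∈ 𝔭} := by
    ext p
    simp only [Set.mem_setOf_eq]
    exact ⟨fun h => hle h, fun h => hI (Ideal.subset_span ⟨p, h, rfl⟩)⟩
  rw [ideal, ideal, hset]

/-- For `φ` log regular at `𝔭`, the ideal `I(𝔭, φ)A_𝔭` is prime (`A_𝔭/I(𝔭)A_𝔭` is a regular local ring, hence a
domain). [cite: Kato1994, Def. (2.1)] -/
theorem isPrime_map_ideal_of_isLogRegularAt (hreg : IsLogRegularAt P φ 𝔭) :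
    ((ideal P φ 𝔭).map (algebraMap A (Localization.AtPrime 𝔭))).IsPrime := by
  haveI : IsRegularLocalRing (Localization.AtPrime 𝔭 ⧸
      (ideal P φ 𝔭).map (algebraMap A (Localization.AtPrime 𝔭))) := hreg.1
  haveI : IsDomain (Localization.AtPrime 𝔭 ⧸
      (ideal P φ 𝔭).map (algebraMap A (Localization.AtPrime 𝔭))) := isDomain_of_isRegularLocalRing _
  exact (Ideal.Quotient.isDomain_iff_prime _).mp inferInstance

omit [𝔭'.IsPrime] in
/-- The generic point `η = I(𝔭)A_𝔭 ∩ A` of the stratum lies below `𝔭`. [folklore] -/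
theorem comap_map_ideal_le
    (hne : (ideal P φ 𝔭).map (algebraMap A (Localization.AtPrime 𝔭)) ≠ ⊤) :
    ((ideal P φ 𝔭).map (algebraMap A (Localization.AtPrime 𝔭))).comap (algebraMap A (Localization.AtPrime 𝔭)) ≤
      𝔭 := by
  intro x hx
  have hx' : algebraMap A (Localization.AtPrime 𝔭) x ∈ maximalIdeal (Localization.AtPrime 𝔭) :=
    le_maximalIdeal hne hx
  exact (IsLocalization.AtPrime.to_map_mem_maximal_iff (Localization.AtPrime 𝔭) 𝔭 x).mp hx'

omit [𝔭'.IsPrime] in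
/-- `I(𝔭) ⊆ η`. [folklore] -/
theorem ideal_le_comap_map_ideal :
    ideal P φ 𝔭 ≤ ((ideal P φ 𝔭).map (algebraMap A (Localization.AtPrime 𝔭))).comap
      (algebraMap A (Localization.AtPrime 𝔭)) :=
  Ideal.le_comap_map

/-- **`h0` at the generic point of the stratum: `𝔪_{A_η} ≤ I(η, φ)A_η`.** Here `η` is any prime of `A` equal to
`I(𝔭)A_𝔭 ∩ A` (so `I(𝔭) ⊆ η ⊆ 𝔭`): an element `a ∈ η` satisfies `c·u·a = c·i` with `i ∈ I(𝔭)` and `c, u ∉ 𝔭 ⊇ η`, so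
`a ∈ I(𝔭)A_η = I(η)A_η`. [cite: Kato1994, Def. (2.1), (7.3)] -/
theorem maximalIdeal_le_map_ideal_genericPoint
    (hne : (ideal P φ 𝔭).map (algebraMap A (Localization.AtPrime 𝔭)) ≠ ⊤)
    (hη : 𝔭' = ((ideal P φ 𝔭).map (algebraMap A (Localization.AtPrime 𝔭))).comap
      (algebraMap A (Localization.AtPrime 𝔭))) :
    maximalIdeal (Localization.AtPrime 𝔭') ≤ (ideal P φ 𝔭').map (algebraMap A (Localization.AtPrime 𝔭')) := by
  have hle : 𝔭' ≤ 𝔭 := hη ▸ comap_map_ideal_le hne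
  have hI : ideal P φ 𝔭 ≤ 𝔭' := hη ▸ ideal_le_comap_map_ideal
  rw [ideal_eq_of_le_of_ideal_le hle hI]
  intro x hx
  obtain ⟨⟨a, s⟩, rfl⟩ := IsLocalization.mk'_surjective 𝔭'.primeCompl x
  have ha : a ∈ 𝔭' := (IsLocalization.AtPrime.mk'_mem_maximal_iff (Localization.AtPrime 𝔭') 𝔭' a s).mp hx
  rw [IsLocalization.mk'_mem_iff]
  -- `a ∈ η`: `algebraMap a ∈ I(𝔭)A_𝔭`
  have ha' : algebraMap A (Localization.AtPrime 𝔭) a ∈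
      (ideal P φ 𝔭).map (algebraMap A (Localization.AtPrime 𝔭)) := by
    have : a ∈ ((ideal P φ 𝔭).map (algebraMap A (Localization.AtPrime 𝔭))).comap
        (algebraMap A (Localization.AtPrime 𝔭)) := hη ▸ ha
    exact this
  obtain ⟨⟨i, u⟩, hiu⟩ :=
    (IsLocalization.mem_map_algebraMap_iff 𝔭.primeCompl (Localization.AtPrime 𝔭)).1 ha'
  obtain ⟨c, hc⟩ := (IsLocalization.eq_iff_exists 𝔭.primeCompl (Localization.AtPrime 𝔭)).1
    (show algebraMap A (Localization.AtPrime 𝔭) (a * (u : A)) = algebraMap A (Localization.AtPrime 𝔭) (i : A) by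
      rw [map_mul]; exact hiu)
  -- `c u ∉ 𝔭'`, so it is a unit in `A_{𝔭'}`
  have hcu : (c : A) * (u : A) ∈ 𝔭'.primeCompl := fun h =>
    (Ideal.IsPrime.mem_or_mem inferInstance h).elim (fun h' => c.2 (hle h')) (fun h' => u.2 (hle h'))
  have hunit : IsUnit (algebraMap A (Localization.AtPrime 𝔭') ((c : A) * (u : A))) :=
    IsLocalization.map_units _ ⟨_, hcu⟩
  obtain ⟨v, hv⟩ := hunit
  have hmul : algebraMap A (Localization.AtPrime 𝔭') a * algebraMap A (Localization.AtPrime 𝔭') ((c : A) * (u : A)) =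
      algebraMap A (Localization.AtPrime 𝔭') ((c : A) * (i : A)) := by
    rw [← map_mul]
    congr 1
    calc a * ((c : A) * (u : A)) = (c : A) * (a * (u : A)) := by ring
      _ = (c : A) * (i : A) := hc
  have key : algebraMap A (Localization.AtPrime 𝔭') a =
      algebraMap A (Localization.AtPrime 𝔭') ((c : A) * (i : A)) * ↑v⁻¹ := by
    rw [← hmul, ← hv, mul_assoc, Units.mul_inv, mul_one]
  rw [key]
  exact Ideal.mul_mem_right _ _ (Ideal.mem_map_of_mem _ (Ideal.mul_mem_left _ _ i.2))

/-- **`hdimA` at the generic point of the stratum: `dim A_η = n − rk F_η`.** If moreover `φ` is log regular at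
`η = I(𝔭)A_𝔭 ∩ A`, then `A_η/I(η)A_η` is a field (its maximal ideal vanishes by
`maximalIdeal_le_map_ideal_genericPoint`), so Kato's condition (2.1)(ii) at `η` reads `dim A_η = n − rk F_η^{gp}`.
[cite: Kato1994, Def. (2.1), (7.3)] -/
theorem ringKrullDim_genericPoint
    (hne : (ideal P φ 𝔭).map (algebraMap A (Localization.AtPrime 𝔭)) ≠ ⊤)
    (hη : 𝔭' = ((ideal P φ 𝔭).map (algebraMap A (Localization.AtPrime 𝔭))).comap
      (algebraMap A (Localization.AtPrime 𝔭)))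
    (hreg' : IsLogRegularAt P φ 𝔭') :
    ringKrullDim (Localization.AtPrime 𝔭') =
      ((n - Module.finrank ℤ (Submodule.span ℤ ((fun p : P => (p : Fin n → ℤ)) '' face P φ 𝔭')) : ℕ) :
        WithBot ℕ∞) := by
  obtain ⟨hR, hdim⟩ := hreg'
  set I' := (ideal P φ 𝔭').map (algebraMap A (Localization.AtPrime 𝔭')) with hI'
  have hI'le : I' ≤ maximalIdeal (Localization.AtPrime 𝔭') := by
    rw [hI', ← Localization.AtPrime.map_eq_maximalIdeal]
    exact Ideal.map_mono (ideal_le P φ 𝔭')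
  have hI'eq : I' = maximalIdeal (Localization.AtPrime 𝔭') :=
    le_antisymm hI'le (maximalIdeal_le_map_ideal_genericPoint hne hη)
  have hmax : I'.IsMaximal := hI'eq ▸ IsLocalRing.maximalIdeal.isMaximal _
  have hfield : IsField (Localization.AtPrime 𝔭' ⧸ I') :=
    (Ideal.Quotient.maximal_ideal_iff_isField_quotient I').mp hmax
  rw [hdim, ringKrullDim_eq_zero_of_isField hfield, zero_add]

end Summit.ResolutionOfSingularities.ResolutionOfSingularities.Theorems.FRationalResolution.FixedStratumGenericPoint

end
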